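import Literature.AlgebraicGeometry.Frobenioids.BaseIdentityPreStepsSlim
import Literature.AlgebraicGeometry.Frobenioids.IsotropicFrobenioid
import Literature.AlgebraicGeometry.Frobenioids.IsotropicFrobeniusTrivial
import HarnessLib

/-!
# Frobenioids I, Theorem 3.4 (iv), first clause: an equivalence of Frobenioids over a
# FROBENIUS-SLIM base preserves `O^▷(−)` and `O^×(−)`

Mochizuki, *The geometry of Frobenioids I: the general theory*, Kyushu J. Math. **62** (2008)
293–400, Thm. 3.4 (iv), kurims text p. 63 ll. 2–4 ("(c) `D_1`, `D_2` are Frobenius-slim. Then `Ψ`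
preserves the submonoids `O^▷(−)`, `O^×(−)`") and its proof p. 66 ll. 13–30
[cite: MochizukiFrdI2008, Thm. 3.4 (iv) p.63]:

> "it follows formally [in light of our assumption that `D_i` is Frobenius-slim] from Proposition 3.3,
> (i) [cf. also Definition 1.3, (i), (a), (b); (iii), (c)], that if `C ∈ Ob(C_i)`, then the
> endomorphisms of `O^▷(C)` are precisely the endomorphisms `γ ∈ End_{C_i}(C)` such that the
> following condition is satisfied: There exist pre-steps `φ : A → B`, `ψ : A → C` and endomorphisms
> `α ∈ End_{C_i}(A)`, `β ∈ End_{C_i}(B)` such that `β ∘ φ = φ ∘ α`, `γ ∘ ψ = ψ ∘ α`, and, moreover,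
> `α` arises as the endomorphism of `A` induced by the image of `1 ∈ ℤ_{≥0} ⊆ 𝔽` via a homomorphism of
> monoids `𝔽 → End((P_i)_A → C_i)^{bs-iso}`. By assertions (ii), (iii), it follows that `Ψ` preserves
> pre-steps, base-isomorphisms, and pull-back morphisms, hence that `Ψ` preserves endomorphisms
> satisfying the above condition. Thus, we conclude that `Ψ` preserves the submonoids `O^▷(−)`,
> `O^×(−)`, as desired."

PROOF-ONLY file (abc-iut cell, sub-node `FrdI:Thm3.4(iv)/L08 UnitsDivisorsPreserved` of
plan/L1/SUBDAG-FrdI-Thm34.md; seat abc-iut-w4-d093). RENDERING OF THE CONDITION used in the kernel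
proof: a "roof" `Y ← X → A'` (`φ : X → Y` a base-isomorphism, `ψ : X → A'`) under a base-isomorphism
`k : A → A'` (an isotropic hull of `A`, so that the roof can be taken in `C^istr`), endomorphisms `α` of
`X`, `f'` of `A'` with `f ≫ k = k ≫ f'`, `α ≫ ψ = ψ ≫ f'`, and the `𝔽`-structure placed at the
Frobenius-trivial vertex `Y`: `α ≫ φ = φ ≫ β` where `β` is the `id_Y`-component of the image of
`γ = (1,1) ∈ 𝔽` under an honest monoid homomorphism `𝔽 → End(C^pl-bk_Y → C)^bs-iso`
(`PreFrobenioidData.EndPlbkBsIso`, cf. `Prop33i_forward` / `Prop33i_converse` of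
`BaseCategoryTheoreticityDefs.lean`) — the vertex at which Prop. 3.3 (i), converse direction
(Frobenius-trivial objects), produces the homomorphism and Prop. 3.3 (i), forward direction, consumes it.
What is PROVED is the printed CONCLUSION of Thm. 3.4 (iv), first clause; the condition is an
intermediate `∃`-statement written out in the theorems (no new name of sort `Prop` is declared), and this
file does not assert that it is literally the printed intermediate condition. The three steps:

* `mem_endSubmonoid_of_roof` — SUFFICIENCY over a Frobenius-slim base: Prop. 3.3 (i), forward
  direction (`prop33i_forward_holds`, `BaseIdentityPreStepsSlim.lean`) puts the `𝔽`-induced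
  endomorphism in `O^▷(Y)`; base-identity and linearity then travel along the roof by the total
  epimorphicity of `D` and cancellation in `N_{≥1}`;
* `exists_roof_of_mem_endSubmonoid` — NECESSITY in any Frobenioid of Frobenius-normalized type: the
  isotropic hull of `A` (Def. 1.3 (vii)(a)), a Frobenius-trivial isotropic object over the same base
  and a roof of pre-steps out of a common isotropic object (Def. 1.3 (i)(a), (b) for `C^istr`,
  Prop. 1.9 (v) `isFrobenioid_istr`), whose legs are co-angular (isotropic source), transport of
  `O^▷` along them (Def. 1.3 (iii)(c)) and Prop. 3.3 (i), converse direction (`prop33i_converse_holds`);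
* `exists_endPlbkBsIso_transportHom` — TRANSPORT along `Ψ`: a natural family of base-isomorphic endomorphisms
  over `Y` goes to one over `Ψ Y` (components `ε ∘ Ψ(ν_{Ψ⁻¹χ}) ∘ ε⁻¹`), multiplicatively, with
  `id`-component `Ψ(ν_{id})`, provided `Ψ` preserves base-isomorphisms and `Ψ⁻¹` preserves pull-back
  morphisms (conclusions of Thm. 3.4 (iii), hypotheses here BY NAME).

Main theorems: `map_mem_endSubmonoid_of_isFrobeniusSlim` (`Ψ` preserves `O^▷(−)`) and
`mapIso_mem_unitsSubgroup_of_isFrobeniusSlim` (`Ψ` preserves `O^×(−)`), for Frobenioids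
`F_i : C_i → F_{Φ_i}` with `C₁` of Frobenius-normalized type and `D₂` Frobenius-slim. Nothing of
[FrdI] is restated as a named fact; no statement of the paper is strengthened (the hypotheses are the
printed ones of Thm. 3.4 (iv) that the printed proof uses, with the outputs of (ii)/(iii) by name).
-/

namespace Literature.AlgebraicGeometry.Frobenioids

open CategoryTheory Opposite

universe w v v' u u'

namespace PreFrobenioid

section OneFrobenioid

variable {D : Type u} [Category.{v} D] {Φ : Dᵒᵖ ⥤ CommMonCat.{w}}
  {C : Type u'} [Category.{v'} C] {F : C ⥤ ElemFrobenioid Φ}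

/-! ### Elementary transfer of base-identity / linearity along intertwining arrows -/

/-- If `α ≫ φ = φ ≫ β` with `Base(φ)` a monomorphism of `D` (e.g. `φ` a base-isomorphism) and `β`
base-identity, then `α` is base-identity. [cite: MochizukiFrdI2008, Thm. 3.4 (iv) p.66] -/
theorem isBaseIdentity_of_comm_of_mono {X Y : C} {φ : X ⟶ Y} [Mono (Base F φ)] {α : X ⟶ X}
    {β : Y ⟶ Y} (h : α ≫ φ = φ ≫ β) (hβ : IsBaseIdentity F β) : IsBaseIdentity F α := by
  unfold IsBaseIdentity at hβ ⊢
  have h' := congrArg (Base F) h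
  rw [base_comp, base_comp, hβ, Category.comp_id] at h'
  exact (cancel_mono (Base F φ)).mp (h'.trans (Category.id_comp _).symm)

/-- If `α ≫ ψ = ψ ≫ γ` with `Base(ψ)` an epimorphism of `D` (every arrow of a totally epimorphic `D`)
and `α` base-identity, then `γ` is base-identity. [cite: MochizukiFrdI2008, Thm. 3.4 (iv) p.66] -/
theorem isBaseIdentity_of_comm_of_epi {X Y : C} {ψ : X ⟶ Y} [Epi (Base F ψ)] {α : X ⟶ X}
    {γ : Y ⟶ Y} (h : α ≫ ψ = ψ ≫ γ) (hα : IsBaseIdentity F α) : IsBaseIdentity F γ := by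
  unfold IsBaseIdentity at hα ⊢
  have h' := congrArg (Base F) h
  rw [base_comp, base_comp, hα, Category.id_comp] at h'
  exact ((cancel_epi (Base F ψ)).mp (h'.symm.trans (Category.comp_id _).symm))

/-- If `α ≫ φ = φ ≫ β` then `deg_Fr(α) = deg_Fr(β)` (cancellation in `N_{≥1}`).
[cite: MochizukiFrdI2008, Rem. 1.1.1 p.21] -/
theorem degFr_eq_of_comm {X Y : C} {φ : X ⟶ Y} {α : X ⟶ X} {β : Y ⟶ Y} (h : α ≫ φ = φ ≫ β) :
    degFr F α = degFr F β := by
  have h' := congrArg (degFr F) h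
  rw [degFr_comp, degFr_comp, mul_comm (degFr F φ)] at h'
  exact mul_right_cancel h'

/-! ### The printed condition characterising `O^▷(−)` over a Frobenius-slim base

The condition of the proof of Thm. 3.4 (iv) (FrdI p. 66) on an endomorphism `f` of `A`, as it is used
below (an `∃`-statement, written out in each theorem so that this file declares no new names of sort
`Prop`): after passage to a base-isomorphism `k : A → A'` (an isotropic hull) with `f ≫ k = k ≫ f'`,
there is a roof `φ : X → Y` (a base-isomorphism), `ψ : X → A'`, an endomorphism `α` of `X` with
`α ≫ ψ = ψ ≫ f'`, and a homomorphism `h : 𝔽 → End(C^pl-bk_Y → C)^bs-iso` whose image of `γ = (1,1)` has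
`id_Y`-component `β` with `α ≫ φ = φ ≫ β`. -/

/-- **Sufficiency** (FrdI p. 66, via Prop. 3.3 (i) forward direction): for a Frobenioid over a
Frobenius-slim base, an endomorphism satisfying the printed condition lies in `O^▷`.
[cite: MochizukiFrdI2008, Thm. 3.4 (iv) p.66] -/
theorem mem_endSubmonoid_of_roof (hF : IsFrobenioid F) (hD : IsFrobeniusSlim D) {A : C}
    (f : End A)
    (hf : ∃ (A' X Y : C) (k : A ⟶ A') (f' : A' ⟶ A') (φ : X ⟶ Y) (ψ : X ⟶ A') (α : X ⟶ X)
      (hY : (PreFrobenioidData.ofFunctor Φ F).IsPullbackMorphism (𝟙 Y))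
      (h : StandardFrobenioid →* (PreFrobenioidData.ofFunctor Φ F).EndPlbkBsIso Y),
      IsBaseIso F k ∧ (show A ⟶ A from f) ≫ k = k ≫ f' ∧ IsBaseIso F φ ∧
        α ≫ φ = φ ≫ (show Y ⟶ Y from (h StandardFrobenioid.gen).app (𝟙 Y) hY) ∧ α ≫ ψ = ψ ≫ f') :
    f ∈ endSubmonoid F A := by
  obtain ⟨A', X, Y, k, f', φ, ψ, α, hY, h, hk, hfk, hφ, hαφ, hαψ⟩ := hf
  have hP := hF.isPreFrobenioid
  -- Prop. 3.3 (i), forward direction: the `id_Y`-component `β` of `h(γ)` lies in `O^▷(Y)`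
  have hβ : (h StandardFrobenioid.gen).app (𝟙 Y) hY ∈ endSubmonoid F Y :=
    prop33i_forward_holds hF Y hD h (𝟙 Y) hY
  obtain ⟨hβb, hβl⟩ := hβ
  -- along `φ` (a base-isomorphism): `α ∈ O^▷(X)`
  haveI : IsIso (Base F φ) := hφ
  have hαb : IsBaseIdentity F α := isBaseIdentity_of_comm_of_mono hαφ hβb
  have hαl : degFr F α = 1 := (degFr_eq_of_comm hαφ).trans hβl
  -- along `ψ` (any arrow; `D` is totally epimorphic): `f' ∈ O^▷(A')`
  haveI : Epi (Base F ψ) := hP.isTotallyEpimorphic_base.epi _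
  have hf'b : IsBaseIdentity F f' := isBaseIdentity_of_comm_of_epi hαψ hαb
  have hf'l : degFr F f' = 1 := (degFr_eq_of_comm hαψ).symm.trans hαl
  -- along `k` (a base-isomorphism): `f ∈ O^▷(A)`
  haveI : IsIso (Base F k) := hk
  exact ⟨isBaseIdentity_of_comm_of_mono hfk hf'b, (degFr_eq_of_comm hfk).trans hf'l⟩

/-! ### Necessity: every element of `O^▷(A)` satisfies the condition -/

/-- Base-identity linear endomorphisms descend along an isotropic hull `k : A → A'`: the induced
endomorphism `f'` of `A'` with `f ≫ k = k ≫ f'` lies in `O^▷(A')`. [cite: MochizukiFrdI2008, Prop. 1.9 (v) p.32] -/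
theorem exists_endSubmonoid_hull (hF : IsFrobenioid F) {A A' : C} {k : A ⟶ A'}
    (hk : IsIsotropicHull F k) (f : End A) (hf : f ∈ endSubmonoid F A) :
    ∃ f' : End A', (show A ⟶ A from f) ≫ k = k ≫ (show A' ⟶ A' from f') ∧ f' ∈ endSubmonoid F A' := by
  have hP := hF.isPreFrobenioid
  obtain ⟨f', hf', -⟩ := hk.2.2.2 ((show A ⟶ A from f) ≫ k) hk.2.2.1
  refine ⟨f', hf'.symm, ?_⟩
  haveI : Epi (Base F k) := hP.isTotallyEpimorphic_base.epi _
  exact ⟨isBaseIdentity_of_comm_of_epi hf'.symm hf.1, (degFr_eq_of_comm hf'.symm).symm.trans hf.2⟩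

/-- **Necessity** (FrdI p. 66: "[cf. also Definition 1.3, (i), (a), (b); (iii), (c)]" and Prop. 3.3 (i),
converse direction): in a Frobenioid of Frobenius-normalized type, every `f ∈ O^▷(A)` satisfies the
printed condition. The roof is taken inside `C^istr` (a Frobenioid, Prop. 1.9 (v)) under the isotropic hull of
`A`, so that its legs are co-angular pre-steps and `O^▷` is transported along them by Def. 1.3 (iii)(c).
[cite: MochizukiFrdI2008, Thm. 3.4 (iv) p.66] -/
theorem exists_roof_of_mem_endSubmonoid (hF : IsFrobenioid F)
    (hFN : (PreFrobenioidData.ofFunctor Φ F).IsOfFrobeniusNormalizedType) {A : C} (f : End A)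
    (hf : f ∈ endSubmonoid F A) :
    ∃ (A' X Y : C) (k : A ⟶ A') (f' : A' ⟶ A') (φ : X ⟶ Y) (ψ : X ⟶ A') (α : X ⟶ X)
      (hY : (PreFrobenioidData.ofFunctor Φ F).IsPullbackMorphism (𝟙 Y))
      (h : StandardFrobenioid →* (PreFrobenioidData.ofFunctor Φ F).EndPlbkBsIso Y),
      IsBaseIso F k ∧ (show A ⟶ A from f) ≫ k = k ≫ f' ∧ IsBaseIso F φ ∧
        α ≫ φ = φ ≫ (show Y ⟶ Y from (h StandardFrobenioid.gen).app (𝟙 Y) hY) ∧ α ≫ ψ = ψ ≫ f' := by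
  have hFi := isFrobenioid_istr hF
  -- the isotropic hull `k : A → A'` and the descended `f' ∈ O^▷(A')`
  obtain ⟨A', k, hk⟩ := hF.vii_a A
  obtain ⟨f', hfk, hf'⟩ := exists_endSubmonoid_hull hF hk f hf
  let a' : Istr F := Istr.mk A' hk.2.2.1
  -- a Frobenius-trivial isotropic object `y` over `Base(A')` and a roof of pre-steps in `C^istr`
  obtain ⟨y, hyFT, ⟨e⟩⟩ := hFi.i_a (baseObj F A')
  obtain ⟨x, φ, ψ, hφ, hψ, -⟩ := hFi.i_b y a' e
  have hφc : IsCoAngularPreStep (istrFunctor F) φ :=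
    ⟨isCoAngular_of_isOfIsotropicType (istrFunctor F) isOfIsotropicType_istr φ, hφ⟩
  have hψc : IsCoAngularPreStep (istrFunctor F) ψ :=
    ⟨isCoAngular_of_isOfIsotropicType (istrFunctor F) isOfIsotropicType_istr ψ, hψ⟩
  -- Def. 1.3 (iii)(c) in `C^istr`: transport `f'` back along `ψ`, then forth along `φ`
  obtain ⟨eψ, heψ⟩ := hFi.iii_c ψ hψc
  obtain ⟨eφ, heφ⟩ := hFi.iii_c φ hφc
  let fi : endSubmonoid (istrFunctor F) a' := ⟨ObjectProperty.homMk f', hf'⟩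
  let αi : endSubmonoid (istrFunctor F) x := eψ.symm fi
  let βi : endSubmonoid (istrFunctor F) y := eφ αi
  have hαψ : (show x ⟶ x from αi.1) ≫ ψ = ψ ≫ (show a' ⟶ a' from fi.1) := by
    have := heψ αi
    rw [MulEquiv.apply_symm_apply] at this
    exact this.symm
  have hαφ : (show x ⟶ x from αi.1) ≫ φ = φ ≫ (show y ⟶ y from βi.1) := (heφ αi).symm
  -- underlying data in `C`
  let X : C := x.obj
  let Y : C := y.obj
  let α : X ⟶ X := (show x ⟶ x from αi.1).hom
  let β : End Y := (show y ⟶ y from βi.1).hom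
  have hβ : β ∈ endSubmonoid F Y := βi.2
  have hαψ' : α ≫ ψ.hom = ψ.hom ≫ (show A' ⟶ A' from f') := congrArg InducedCategory.Hom.hom hαψ
  have hαφ' : α ≫ φ.hom = φ.hom ≫ (show Y ⟶ Y from β) := congrArg InducedCategory.Hom.hom hαφ
  -- Prop. 3.3 (i), converse direction, at the Frobenius-trivial `Y`
  have hYFT : (PreFrobenioidData.ofFunctor Φ F).IsFrobeniusTrivial Y :=
    (PreFrobenioidData.ofFunctor_isFrobeniusTrivial F Y).mpr ((isFrobeniusTrivial_istr_iff hF y).mp hyFT)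
  have hY : (PreFrobenioidData.ofFunctor Φ F).IsPullbackMorphism (𝟙 Y) :=
    PreFrobenioidData.isPullbackMorphism_id _ Y
  obtain ⟨h, hh⟩ := PreFrobenioidData.prop33i_converse_holds (PreFrobenioidData.ofFunctor Φ F) Y hFN hYFT
    hY β hβ
  refine ⟨A', X, Y, k, f', φ.hom, ψ.hom, α, hY, h, hk.2.1.2, hfk, hφ.2, ?_, hαψ'⟩
  rw [hh]
  exact hαφ'

end OneFrobenioid

section TwoFrobenioids

variable {D₁ : Type u} [Category.{v} D₁] {Φ₁ : D₁ᵒᵖ ⥤ CommMonCat.{w}} {C₁ : Type u'} [Category.{v'} C₁]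
  {D₂ : Type u} [Category.{v} D₂] {Φ₂ : D₂ᵒᵖ ⥤ CommMonCat.{w}} {C₂ : Type u'} [Category.{v'} C₂]
  {F₁ : C₁ ⥤ ElemFrobenioid Φ₁} {F₂ : C₂ ⥤ ElemFrobenioid Φ₂}

/-! ### Transport of `End(C^pl-bk_Y → C₁)^bs-iso` along an equivalence `Ψ : C₁ ⥲ C₂` -/

/-- **Transport of natural families of base-isomorphic endomorphisms along `Ψ`** (the sentence "`Ψ`
preserves pre-steps, base-isomorphisms, and pull-back morphisms, hence … preserves endomorphisms
satisfying the above condition" of the proof of Thm. 3.4 (iv), p. 66): if `Ψ` preserves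
base-isomorphisms and `Ψ⁻¹` preserves pull-back morphisms (Thm. 3.4 (iii)), there is a homomorphism of
monoids `End(C₁^pl-bk_Y → C₁)^bs-iso → End(C₂^pl-bk_{ΨY} → C₂)^bs-iso` — the component of the image of
`ν` at a pull-back morphism `χ : Z → Ψ Y` is the conjugate `ε_Z ∘ Ψ(ν_{Ψ⁻¹χ ≫ η_Y⁻¹}) ∘ ε_Z⁻¹` by the counit
— whose `id_{ΨY}`-components are `Ψ(ν_{id_Y})`. [cite: MochizukiFrdI2008, Thm. 3.4 (iv) p.66] -/
theorem exists_endPlbkBsIso_transportHom (Ψ : C₁ ≌ C₂)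
    (hbi : PreFrobenioidData.PreservesMor Ψ.functor (PreFrobenioidData.ofFunctor Φ₁ F₁).IsBaseIso
      (PreFrobenioidData.ofFunctor Φ₂ F₂).IsBaseIso)
    (hpb' : PreFrobenioidData.PreservesMor Ψ.inverse (PreFrobenioidData.ofFunctor Φ₂ F₂).IsPullbackMorphism
      (PreFrobenioidData.ofFunctor Φ₁ F₁).IsPullbackMorphism)
    (Y : C₁) (hY : (PreFrobenioidData.ofFunctor Φ₁ F₁).IsPullbackMorphism (𝟙 Y))
    (hΨY : (PreFrobenioidData.ofFunctor Φ₂ F₂).IsPullbackMorphism (𝟙 (Ψ.functor.obj Y))) :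
    ∃ T : (PreFrobenioidData.ofFunctor Φ₁ F₁).EndPlbkBsIso Y →*
        (PreFrobenioidData.ofFunctor Φ₂ F₂).EndPlbkBsIso (Ψ.functor.obj Y),
      ∀ ν, (show Ψ.functor.obj Y ⟶ Ψ.functor.obj Y from (T ν).app (𝟙 _) hΨY) =
        Ψ.functor.map (show Y ⟶ Y from ν.app (𝟙 Y) hY) := by
  -- the unit at `Y` and the counit, with their types spelled out
  obtain ⟨η, hη⟩ : ∃ η : Y ≅ Ψ.inverse.obj (Ψ.functor.obj Y), η = Ψ.unitIso.app Y := ⟨_, rfl⟩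
  obtain ⟨ε, hε⟩ : ∃ ε : ∀ Z : C₂, Ψ.functor.obj (Ψ.inverse.obj Z) ≅ Z, ∀ Z, ε Z = Ψ.counitIso.app Z :=
    ⟨_, fun _ => rfl⟩
  have hεinv : ∀ {Z Z' : C₂} (g : Z' ⟶ Z),
      g ≫ (ε Z).inv = (ε Z').inv ≫ Ψ.functor.map (Ψ.inverse.map g) := by
    intro Z Z' g
    rw [hε, hε]
    have := Ψ.counitIso.inv.naturality g
    dsimp at this
    exact this
  have hεhom : ∀ {Z Z' : C₂} (g : Z' ⟶ Z),
      Ψ.functor.map (Ψ.inverse.map g) ≫ (ε Z).hom = (ε Z').hom ≫ g := by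
    intro Z Z' g
    rw [hε, hε]
    have := Ψ.counitIso.hom.naturality g
    dsimp at this
    exact this
  have htri₁ : Ψ.functor.map η.hom ≫ (ε (Ψ.functor.obj Y)).hom = 𝟙 _ := by
    rw [hη, hε]; exact Ψ.functor_unitIso_comp Y
  have htri₂ : (ε (Ψ.functor.obj Y)).inv ≫ Ψ.functor.map η.inv = 𝟙 _ := by
    rw [hη, hε]; exact Ψ.counitIso_functor_comp Y
  -- the pull-back morphism `Ψ⁻¹χ ≫ η⁻¹` over `Y` attached to a pull-back morphism `χ` over `Ψ Y`
  have hpb₁ : ∀ {Z : C₂} (χ : Z ⟶ Ψ.functor.obj Y), (PreFrobenioidData.ofFunctor Φ₂ F₂).IsPullbackMorphism χ →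
      (PreFrobenioidData.ofFunctor Φ₁ F₁).IsPullbackMorphism (Ψ.inverse.map χ ≫ η.inv) := by
    intro Z χ hχ
    rw [PreFrobenioidData.ofFunctor_isPullbackMorphism]
    exact IsPullbackMorphism.comp F₁ ((PreFrobenioidData.ofFunctor_isPullbackMorphism F₁ _).mp (hpb' χ hχ))
      (isPullbackMorphism_of_isIso F₁ _)
  -- the transported family
  let T₀ : (PreFrobenioidData.ofFunctor Φ₁ F₁).EndPlbkBsIso Y →
      (PreFrobenioidData.ofFunctor Φ₂ F₂).EndPlbkBsIso (Ψ.functor.obj Y) := fun ν =>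
    { app := fun Z χ hχ => (ε Z).inv ≫
        Ψ.functor.map (show Ψ.inverse.obj Z ⟶ Ψ.inverse.obj Z from ν.app _ (hpb₁ χ hχ)) ≫ (ε Z).hom
      naturality := by
        intro Z Z' χ hχ χ' hχ' g hg
        have hg₁ : Ψ.inverse.map g ≫ (Ψ.inverse.map χ ≫ η.inv) = Ψ.inverse.map χ' ≫ η.inv := by
          rw [← Category.assoc, ← CategoryTheory.Functor.map_comp, hg]
        have key := congrArg (fun t => Ψ.functor.map t)
          (ν.naturality _ (hpb₁ χ hχ) _ (hpb₁ χ' hχ') (Ψ.inverse.map g) hg₁)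
        simp only [CategoryTheory.Functor.map_comp] at key
        change g ≫ (ε Z).inv ≫ _ ≫ (ε Z).hom = ((ε Z').inv ≫ _ ≫ (ε Z').hom) ≫ g
        rw [← Category.assoc g, hεinv, Category.assoc, ← Category.assoc (Ψ.functor.map (Ψ.inverse.map g)),
          key, Category.assoc, hεhom, Category.assoc, Category.assoc]
      isBaseIso := by
        intro Z χ hχ
        haveI : IsIso (Base F₂ (Ψ.functor.map (show Ψ.inverse.obj Z ⟶ Ψ.inverse.obj Z from
            ν.app _ (hpb₁ χ hχ)))) := hbi _ (ν.isBaseIso _ _)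
        haveI : IsIso (Base F₂ (ε Z).inv) := isBaseIso_of_isIso F₂ _
        haveI : IsIso (Base F₂ (ε Z).hom) := isBaseIso_of_isIso F₂ _
        change IsIso (Base F₂ ((ε Z).inv ≫ Ψ.functor.map _ ≫ (ε Z).hom))
        rw [base_comp, base_comp]
        infer_instance }
  refine ⟨{ toFun := T₀, map_one' := ?_, map_mul' := fun ν μ => ?_ }, fun ν => ?_⟩
  · refine PreFrobenioidData.EndPlbkBsIso.ext' fun Z χ hχ => ?_
    change (ε Z).inv ≫ Ψ.functor.map (𝟙 _) ≫ (ε Z).hom = 𝟙 Z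
    rw [CategoryTheory.Functor.map_id, Category.id_comp, Iso.inv_hom_id]
  · refine PreFrobenioidData.EndPlbkBsIso.ext' fun Z χ hχ => ?_
    change (ε Z).inv ≫
        Ψ.functor.map ((show Ψ.inverse.obj Z ⟶ Ψ.inverse.obj Z from μ.app _ (hpb₁ χ hχ)) ≫
          (show Ψ.inverse.obj Z ⟶ Ψ.inverse.obj Z from ν.app _ (hpb₁ χ hχ))) ≫ (ε Z).hom =
      ((ε Z).inv ≫ Ψ.functor.map (show Ψ.inverse.obj Z ⟶ Ψ.inverse.obj Z from μ.app _ (hpb₁ χ hχ)) ≫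
          (ε Z).hom) ≫
        ((ε Z).inv ≫ Ψ.functor.map (show Ψ.inverse.obj Z ⟶ Ψ.inverse.obj Z from ν.app _ (hpb₁ χ hχ)) ≫
          (ε Z).hom)
    rw [CategoryTheory.Functor.map_comp]
    simp only [Category.assoc, Iso.hom_inv_id_assoc]
  · -- the `id_{ΨY}`-component: naturality of `ν` along `η⁻¹ : Ψ⁻¹Ψ Y → Y` and the triangle identities
    change (ε _).inv ≫ Ψ.functor.map (show _ ⟶ _ from ν.app _ (hpb₁ (𝟙 _) hΨY)) ≫ (ε _).hom = _
    have hg : η.inv ≫ 𝟙 Y = Ψ.inverse.map (𝟙 (Ψ.functor.obj Y)) ≫ η.inv := by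
      rw [CategoryTheory.Functor.map_id, Category.id_comp, Category.comp_id]
    have key := ν.naturality (𝟙 Y) hY _ (hpb₁ (𝟙 _) hΨY) η.inv hg
    have key' : (show Ψ.inverse.obj (Ψ.functor.obj Y) ⟶ Ψ.inverse.obj (Ψ.functor.obj Y) from
        ν.app _ (hpb₁ (𝟙 _) hΨY)) = η.inv ≫ (show Y ⟶ Y from ν.app (𝟙 Y) hY) ≫ η.hom := by
      rw [← Category.assoc, key, Category.assoc, Iso.inv_hom_id, Category.comp_id]
    rw [key', CategoryTheory.Functor.map_comp, CategoryTheory.Functor.map_comp, Category.assoc,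
      Category.assoc, htri₁, Category.comp_id, ← Category.assoc, htri₂, Category.id_comp]

/-! ### `Ψ` preserves the condition, hence `O^▷(−)` and `O^×(−)` -/

/-- `Ψ` carries endomorphisms satisfying the printed condition (for `C₁`) to endomorphisms satisfying it
(for `C₂`), provided `Ψ` preserves base-isomorphisms and `Ψ⁻¹` preserves pull-back morphisms (FrdI p. 66).
[cite: MochizukiFrdI2008, Thm. 3.4 (iv) p.66] -/
theorem exists_roof_map (Ψ : C₁ ≌ C₂)
    (hbi : PreFrobenioidData.PreservesMor Ψ.functor (PreFrobenioidData.ofFunctor Φ₁ F₁).IsBaseIso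
      (PreFrobenioidData.ofFunctor Φ₂ F₂).IsBaseIso)
    (hpb' : PreFrobenioidData.PreservesMor Ψ.inverse (PreFrobenioidData.ofFunctor Φ₂ F₂).IsPullbackMorphism
      (PreFrobenioidData.ofFunctor Φ₁ F₁).IsPullbackMorphism)
    {A : C₁} {f : A ⟶ A}
    (hf : ∃ (A' X Y : C₁) (k : A ⟶ A') (f' : A' ⟶ A') (φ : X ⟶ Y) (ψ : X ⟶ A') (α : X ⟶ X)
      (hY : (PreFrobenioidData.ofFunctor Φ₁ F₁).IsPullbackMorphism (𝟙 Y))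
      (h : StandardFrobenioid →* (PreFrobenioidData.ofFunctor Φ₁ F₁).EndPlbkBsIso Y),
      IsBaseIso F₁ k ∧ f ≫ k = k ≫ f' ∧ IsBaseIso F₁ φ ∧
        α ≫ φ = φ ≫ (show Y ⟶ Y from (h StandardFrobenioid.gen).app (𝟙 Y) hY) ∧ α ≫ ψ = ψ ≫ f') :
    ∃ (A' X Y : C₂) (k : Ψ.functor.obj A ⟶ A') (f' : A' ⟶ A') (φ : X ⟶ Y) (ψ : X ⟶ A') (α : X ⟶ X)
      (hY : (PreFrobenioidData.ofFunctor Φ₂ F₂).IsPullbackMorphism (𝟙 Y))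
      (h : StandardFrobenioid →* (PreFrobenioidData.ofFunctor Φ₂ F₂).EndPlbkBsIso Y),
      IsBaseIso F₂ k ∧ Ψ.functor.map f ≫ k = k ≫ f' ∧ IsBaseIso F₂ φ ∧
        α ≫ φ = φ ≫ (show Y ⟶ Y from (h StandardFrobenioid.gen).app (𝟙 Y) hY) ∧ α ≫ ψ = ψ ≫ f' := by
  obtain ⟨A', X, Y, k, f', φ, ψ, α, hY, h, hk, hfk, hφ, hαφ, hαψ⟩ := hf
  have hΨY : (PreFrobenioidData.ofFunctor Φ₂ F₂).IsPullbackMorphism (𝟙 (Ψ.functor.obj Y)) :=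
    PreFrobenioidData.isPullbackMorphism_id _ _
  obtain ⟨T, hT⟩ := exists_endPlbkBsIso_transportHom Ψ hbi hpb' Y hY hΨY
  refine ⟨Ψ.functor.obj A', Ψ.functor.obj X, Ψ.functor.obj Y, Ψ.functor.map k, Ψ.functor.map f',
    Ψ.functor.map φ, Ψ.functor.map ψ, Ψ.functor.map α, hΨY, T.comp h, hbi k hk, ?_, hbi φ hφ, ?_, ?_⟩
  · rw [← CategoryTheory.Functor.map_comp, hfk, CategoryTheory.Functor.map_comp]
  · have happ : (show Ψ.functor.obj Y ⟶ Ψ.functor.obj Y from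
        ((T.comp h) StandardFrobenioid.gen).app (𝟙 _) hΨY) =
          Ψ.functor.map (show Y ⟶ Y from (h StandardFrobenioid.gen).app (𝟙 Y) hY) :=
      hT (h StandardFrobenioid.gen)
    rw [happ, ← CategoryTheory.Functor.map_comp, hαφ, CategoryTheory.Functor.map_comp]
  · rw [← CategoryTheory.Functor.map_comp, hαψ, CategoryTheory.Functor.map_comp]

/-- **[FrdI] Thm. 3.4 (iv), "`Ψ` preserves `O^▷(−)`"** over a Frobenius-slim base `D₂` (abc-iut node
`FrdI:Thm3.4(iv)`, sub-node L08 `UnitsDivisorsPreserved`): for Frobenioids `F_i : C_i → F_{Φ_i}` with `C₁`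
of Frobenius-normalized type (part of "standard type", Def. 3.1 (i)(c)) and `D₂` Frobenius-slim, and an
equivalence `Ψ : C₁ ⥲ C₂` that preserves base-isomorphisms and whose quasi-inverse preserves pull-back
morphisms (conclusions of Thm. 3.4 (iii) for `Ψ`, `Ψ⁻¹`): `f ∈ O^▷(A) ⇒ Ψ(f) ∈ O^▷(Ψ A)`.
[cite: MochizukiFrdI2008, Thm. 3.4 (iv) p.63] -/
theorem map_mem_endSubmonoid_of_isFrobeniusSlim (hF₁ : IsFrobenioid F₁) (hF₂ : IsFrobenioid F₂)
    (hFN₁ : (PreFrobenioidData.ofFunctor Φ₁ F₁).IsOfFrobeniusNormalizedType) (hD₂ : IsFrobeniusSlim D₂)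
    (Ψ : C₁ ≌ C₂)
    (hbi : PreFrobenioidData.PreservesMor Ψ.functor (PreFrobenioidData.ofFunctor Φ₁ F₁).IsBaseIso
      (PreFrobenioidData.ofFunctor Φ₂ F₂).IsBaseIso)
    (hpb' : PreFrobenioidData.PreservesMor Ψ.inverse (PreFrobenioidData.ofFunctor Φ₂ F₂).IsPullbackMorphism
      (PreFrobenioidData.ofFunctor Φ₁ F₁).IsPullbackMorphism)
    {A : C₁} (f : End A) (hf : f ∈ endSubmonoid F₁ A) :
    Ψ.functor.map f ∈ endSubmonoid F₂ (Ψ.functor.obj A) :=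
  mem_endSubmonoid_of_roof hF₂ hD₂ (Ψ.functor.map f)
    (exists_roof_map Ψ hbi hpb' (exists_roof_of_mem_endSubmonoid hF₁ hFN₁ f hf))

/-- **[FrdI] Thm. 3.4 (iv), "`Ψ` preserves `O^×(−)`"** over a Frobenius-slim base `D₂`, same hypotheses:
`u ∈ O^×(A) ⇒ Ψ(u) ∈ O^×(Ψ A)`. [cite: MochizukiFrdI2008, Thm. 3.4 (iv) p.63] -/
theorem mapIso_mem_unitsSubgroup_of_isFrobeniusSlim (hF₁ : IsFrobenioid F₁) (hF₂ : IsFrobenioid F₂)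
    (hFN₁ : (PreFrobenioidData.ofFunctor Φ₁ F₁).IsOfFrobeniusNormalizedType) (hD₂ : IsFrobeniusSlim D₂)
    (Ψ : C₁ ≌ C₂)
    (hbi : PreFrobenioidData.PreservesMor Ψ.functor (PreFrobenioidData.ofFunctor Φ₁ F₁).IsBaseIso
      (PreFrobenioidData.ofFunctor Φ₂ F₂).IsBaseIso)
    (hpb' : PreFrobenioidData.PreservesMor Ψ.inverse (PreFrobenioidData.ofFunctor Φ₂ F₂).IsPullbackMorphism
      (PreFrobenioidData.ofFunctor Φ₁ F₁).IsPullbackMorphism)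
    {A : C₁} (u : Aut A) (hu : u ∈ unitsSubgroup F₁ A) :
    Ψ.functor.mapIso u ∈ unitsSubgroup F₂ (Ψ.functor.obj A) :=
  map_mem_endSubmonoid_of_isFrobeniusSlim hF₁ hF₂ hFN₁ hD₂ Ψ hbi hpb' (show End A from u.hom) hu

end TwoFrobenioids

end PreFrobenioid

end Literature.AlgebraicGeometry.Frobenioids
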